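import Summits.CriticalPhenomena.PercolationContinuityZ3.Theorems.PercNearOneGluingNoHeavyLowerTailSwitchRelaxFinc12ChecksB
import HarnessLib

/-!
# Finite-relaxation replay of the clean switching certificate `Finc12`: kernel checks at input types 10–14 and assembly

Support file (prover prim-masterthm-p1 gen 2; `--supports stmt-CriticalPhenomena-4575`).  No named facts, no sorries.  Split from
`…SwitchRelaxFinc12` only to keep each file's kernel time small.
-/

namespace Summit.CriticalPhenomena.PercolationContinuityZ3.Theorems

namespace SwitchRelax

namespace Finc12

/-- Kernel evaluation of the finite relaxation at input type `10`. [this work] -/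
theorem checkAt_10 : certFinc12.checkAt 10 = true := by decide +kernel

/-- Kernel evaluation of the finite relaxation at input type `11`. [this work] -/
theorem checkAt_11 : certFinc12.checkAt 11 = true := by decide +kernel

/-- Kernel evaluation of the finite relaxation at input type `12`. [this work] -/
theorem checkAt_12 : certFinc12.checkAt 12 = true := by decide +kernel

/-- Kernel evaluation of the finite relaxation at input type `13`. [this work] -/
theorem checkAt_13 : certFinc12.checkAt 13 = true := by decide +kernel

/-- Kernel evaluation of the finite relaxation at input type `14`. [this work] -/
theorem checkAt_14 : certFinc12.checkAt 14 = true := by decide +kernel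

/-- **Kernel evaluation of the finite relaxation**: the check passes. [this work] -/
theorem check_cert : certFinc12.check = true :=
  Cert.check_of_pieces certFinc12 wf_cert checkAt_0 checkAt_1 checkAt_2 checkAt_3 checkAt_4 checkAt_5 checkAt_6 checkAt_7 checkAt_8 checkAt_9 checkAt_10 checkAt_11 checkAt_12 checkAt_13 checkAt_14

/-- **Pointwise lemma** for `Finc12`: `S ≤ 0` at every configuration triple of every finite graph. [this work] -/
theorem Sreal_nonpos {V : Type*} [Fintype V] [DecidableEq V] (τ : Fin 4 → V) (x : Fin 3 → Finset (Sym2 V)) :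
    Sreal τ certFinc12 x ≤ 0 :=
  Cert.sound τ certFinc12 check_cert x

end Finc12

end SwitchRelax

end Summit.CriticalPhenomena.PercolationContinuityZ3.Theorems
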